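import Mathlib
import Summits.ValiantsHypothesis.ValiantsHypothesis.Theorems.NewtonUnitEquationsTwoProductsFormalLogLinearisationLiftedPairDegreeTwo

/-!
# Crux `TwoProducts` (stmt-ValiantsHypothesis-5906), line `formal-log-linearisation`: tools for the linear `m = 2` count

Helper lemmas for `…FormalLogLinearisationLiftedPairLinear.lean` (`liftedPencilCount_two_linear`): the shapes of multi-indices of
total degree `≤ 2` (`shape_of_sum_le_two`), the grading of unit vectors and pairs (`grading_single`, `grading_pair`), the
weight `(−1,−c)` of a planar point (`weight_point`), and the parallelogram-normal-form values of the unequal-moment function on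
dead coordinates for two points against two points (`G_pair_eq`: `G(e_a+e_b) = u_a v_b + u_b v_a`; `G_double_eq`:
`G(2e_a) = 2 u_a v_a`, with `u = B₀ − A₀`, `v = B₁ − A₀`, dead: `A₀ + A₁ = B₀ + B₁`).

Honest framing: elementary toolkit; the engine `LogSumEngine` and the crux `TwoProducts` are OPEN; nothing here bears on
`VP ≠ VNP`.
-/

set_option linter.dupNamespace false

noncomputable section

open scoped BigOperators

namespace Summit.ValiantsHypothesis.ValiantsHypothesis.Theorems.NewtonUnitEquations.TwoProducts.FormalLogLinearisation

/-! ## Small multi-indices -/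

/-- A multi-index of total degree `≤ 2` is `0`, a unit vector, a double, or a sum of two distinct unit vectors. [folklore] -/
theorem shape_of_sum_le_two {s : ℕ} (μ : Fin s → ℕ) (hμ : ∑ i, μ i ≤ 2) :
    μ = 0 ∨ (∃ i, μ = Pi.single i 1) ∨ (∃ i, μ = Pi.single i 2) ∨
      ∃ i k, i ≠ k ∧ μ = Pi.single i 1 + Pi.single k 1 := by
  classical
  have peel : ∀ ν : Fin s → ℕ, (∑ i, ν i) ≠ 0 →
      ∃ i, ν = Function.update ν i (ν i - 1) + Pi.single i 1 ∧
        ∑ l, (Function.update ν i (ν i - 1)) l + 1 = ∑ l, ν l := by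
    intro ν hν
    obtain ⟨i, -, hi⟩ := Finset.exists_ne_zero_of_sum_ne_zero hν
    refine ⟨i, ?_, ?_⟩
    · funext l
      by_cases hl : l = i
      · subst hl; rw [Pi.add_apply, Function.update_self, Pi.single_eq_same]; omega
      · rw [Pi.add_apply, Function.update_of_ne hl, Pi.single_eq_of_ne hl, add_zero]
    · have h1 : ∑ l, ν l = ν i + ∑ l ∈ Finset.univ.erase i, ν l :=
        (Finset.add_sum_erase _ _ (Finset.mem_univ i)).symm
      have h2 : ∑ l, Function.update ν i (ν i - 1) l =
          (ν i - 1) + ∑ l ∈ Finset.univ.erase i, Function.update ν i (ν i - 1) l := by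
        rw [← Finset.add_sum_erase _ _ (Finset.mem_univ i), Function.update_self]
      have h3 : ∑ l ∈ Finset.univ.erase i, Function.update ν i (ν i - 1) l = ∑ l ∈ Finset.univ.erase i, ν l :=
        Finset.sum_congr rfl fun l hl => by rw [Function.update_of_ne (Finset.ne_of_mem_erase hl)]
      rw [h2, h3, h1]; omega
  have zero_of_sum : ∀ ν : Fin s → ℕ, ∑ l, ν l = 0 → ν = 0 := fun ν h => by
    funext l; have := Finset.sum_eq_zero_iff.mp h l (Finset.mem_univ l); simpa using this
  rcases Nat.eq_zero_or_pos (∑ i, μ i) with h0 | h1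
  · exact Or.inl (zero_of_sum μ h0)
  obtain ⟨i, hμ1, hs1⟩ := peel μ (by omega)
  set ν := Function.update μ i (μ i - 1) with hν
  rcases Nat.eq_zero_or_pos (∑ l, ν l) with hν0 | hν1
  · right; left
    exact ⟨i, by rw [hμ1, zero_of_sum ν hν0, zero_add]⟩
  obtain ⟨k, hν2, hs2⟩ := peel ν (by omega)
  set ρ := Function.update ν k (ν k - 1) with hρ
  have hρ0 : ρ = 0 := zero_of_sum ρ (by omega)
  rw [hρ0, zero_add] at hν2
  by_cases hki : k = i
  · subst hki
    right; right; left
    refine ⟨k, ?_⟩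
    rw [hμ1, hν2, ← Pi.single_add]
  · right; right; right
    exact ⟨k, i, hki, by rw [hμ1, hν2]⟩

/-! ## The planar dictionary -/

/-- The grading of a unit vector. [folklore] -/
theorem grading_single {s : ℕ} (θ₁ θ₂ : Fin s → ℝ) (c : ℝ) (i : Fin s) (n : ℕ) :
    ∑ l, (θ₁ l + c * θ₂ l) * ((Pi.single i n : Fin s → ℕ) l : ℝ) = (n : ℝ) * (θ₁ i + c * θ₂ i) := by
  classical
  rw [Finset.sum_eq_single i (fun l _ hl => by rw [Pi.single_eq_of_ne hl, Nat.cast_zero, mul_zero])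
    (fun h => absurd (Finset.mem_univ i) h), Pi.single_eq_same]
  ring

/-- The grading of a sum of two unit vectors. [folklore] -/
theorem grading_pair {s : ℕ} (θ₁ θ₂ : Fin s → ℝ) (c : ℝ) (i k : Fin s) :
    ∑ l, (θ₁ l + c * θ₂ l) * ((Pi.single i 1 + Pi.single k 1 : Fin s → ℕ) l : ℝ) =
      (θ₁ i + c * θ₂ i) + (θ₁ k + c * θ₂ k) := by
  have h : ∀ l, (θ₁ l + c * θ₂ l) * ((Pi.single i 1 + Pi.single k 1 : Fin s → ℕ) l : ℝ) =
      (θ₁ l + c * θ₂ l) * ((Pi.single i 1 : Fin s → ℕ) l : ℝ) +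
        (θ₁ l + c * θ₂ l) * ((Pi.single k 1 : Fin s → ℕ) l : ℝ) := by
    intro l; rw [Pi.add_apply, Nat.cast_add, mul_add]
  simp only [h, Finset.sum_add_distrib, grading_single, Nat.cast_one, one_mul]

/-- The weight `(−1, −c)` of the planar point `(θ₁ i, θ₂ i)` is minus the grading. [folklore] -/
theorem weight_point {s : ℕ} (θ₁ θ₂ : Fin s → ℝ) (c : ℝ) (i : Fin s) :
    ![-1, -c] ⬝ᵥ ![θ₁ i, θ₂ i] = -(θ₁ i + c * θ₂ i) := by
  simp [dotProduct, Fin.sum_univ_two]; ring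

/-! ## Algebra on dead coordinates (parallelogram normal form) -/

/-- On two dead coordinates `a ≠ b`: `G(e_a + e_b) = u_a v_b + u_b v_a`. [folklore] -/
theorem G_pair_eq {s : ℕ} (A B : Fin 2 → Fin s → ℂ) (a b : Fin s)
    (ha : A 0 a + A 1 a = B 0 a + B 1 a) (hb : A 0 b + A 1 b = B 0 b + B 1 b) :
    (∑ j, ∏ i, A j i ^ (Pi.single a 1 + Pi.single b 1 : Fin s → ℕ) i) -
        (∑ j, ∏ i, B j i ^ (Pi.single a 1 + Pi.single b 1 : Fin s → ℕ) i) =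
      (B 0 a - A 0 a) * (B 1 b - A 0 b) + (B 0 b - A 0 b) * (B 1 a - A 0 a) := by
  simp only [Fin.sum_univ_two, prod_pow_add', prod_pow_single, pow_one]
  have h1 : A 1 a = B 0 a + B 1 a - A 0 a := by linear_combination ha
  have h2 : A 1 b = B 0 b + B 1 b - A 0 b := by linear_combination hb
  rw [h1, h2]; ring

/-- On a dead coordinate: `G(2 e_a) = 2 u_a v_a`. [folklore] -/
theorem G_double_eq {s : ℕ} (A B : Fin 2 → Fin s → ℂ) (a : Fin s) (ha : A 0 a + A 1 a = B 0 a + B 1 a) :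
    (∑ j, ∏ i, A j i ^ (Pi.single a 2 : Fin s → ℕ) i) - (∑ j, ∏ i, B j i ^ (Pi.single a 2 : Fin s → ℕ) i) =
      2 * ((B 0 a - A 0 a) * (B 1 a - A 0 a)) := by
  simp only [Fin.sum_univ_two, prod_pow_single]
  have h1 : A 1 a = B 0 a + B 1 a - A 0 a := by linear_combination ha
  rw [h1]; ring

end Summit.ValiantsHypothesis.ValiantsHypothesis.Theorems.NewtonUnitEquations.TwoProducts.FormalLogLinearisation

end
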